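import Summits.NavierStokesRegularity.NavierStokesRegularity.Theorems.EulerZoomLiouvillePowerGaugeEulerLiouvilleProfileEnergyTools

/-!
# Profile local energy equality, III: the tested identity at a fixed mollification level
# (crux `EulerZoomLiouville.PowerGaugeEulerLiouville` = stmt-NavierStokesRegularity-19832, line `birth`, rung C1)

Route `EulerZoomLiouville` (NavierStokesRegularity).  `integral_integrandN_eq_zero`: for a test function `σ`
supported in `S`, a smooth field `W` divergence free on `S`, and `(V, P)` solving the weak self-similar Euler profile
equation with `V` weakly divergence free (`V ∈ L²`, `P ∈ L¹` near `supp σ`), the three identities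
(E) the weak profile equation tested with the test field `ψ = σW`,
(S) the weak divergence-free identity tested with the test function `½σ|W|²` (Serrin's skew-symmetry step),
(D) the divergence theorem for `½σ|W|² · y`,
combine into `∫ Iₙ = 0` for the explicit fixed-level integrand `Iₙ` of `…ProfileEnergyPointwise.lean`, which is
integrable.  (The pressure term uses `div W = 0` on `S`: this is why the mollified TRUNCATED profile, which agrees
with the divergence-free mollified profile near `supp σ`, is the right approximant.)

Context.  An EXACTLY SELF-SIMILAR member `u(t,x) = (−t)^{γ−1} V(x/(−t)^γ)`, `p = (−t)^{2(γ−1)} P(x/(−t)^γ)`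
(`γ = 1/(2+ρ)`) of Seregin's power-gauged ancient Euler class (the crux, stmt-NavierStokesRegularity-19832) has an
`H¹_loc` profile (`E`-gauge) with `P ∈ L^{3/2}_loc` (`D`-gauge) solving the profile equation
`(1−γ)V + γ(y·∇)V + (V·∇)V + ∇P = 0` weakly.  The lineage's profile dictionary transfers the local energy
INEQUALITY only (`selfSimilar_profile_energy_le_add_flux`); critic-2's K3 (the NSI cascade) shows the open core of
the crux needs a lever that USES THE EULER IDENTITY.  This chain of files supplies the first such lever on rung C1:
velocity-testing the weak profile equation (legitimate for `H¹_loc` profiles because the equation is steady-type: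
`H¹_loc ⊂ L⁶_loc` closes the trilinear term; Chae–Shvydkoy 2013 §2.2 ASSUME `C¹_loc` for the local energy equality)
gives the profile LOCAL ENERGY EQUALITY `(2 − 5γ)∫σ|V|² = ∫(|V|²+2P)⟪V,∇σ⟫ + γ∫|V|²⟪y,∇σ⟫`.
WHAT THIS IS NOT: not NS regularity, not the crux — a C1 tool, `--supports` stmt-19832. [folklore]
-/

noncomputable section

set_option linter.dupNamespace false

open MeasureTheory Set Filter Topology Metric Function TopologicalSpace
open scoped ENNReal NNReal RealInnerProductSpace ContDiff Convolution

namespace Summit.NavierStokesRegularity.NavierStokesRegularity.Theorems.PowerGaugeEulerLiouville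

open Literature.Analysis Literature.Analysis.FunctionSpaces Literature.Analysis.FluidPDE

namespace ProfileEnergy

/-! ## The identity at fixed mollification level -/

section FixedN

/-- **Velocity-testing at a fixed mollification level.**  With `σ` a test function supported in `S`,
`W` smooth and divergence free on `S`, the weak profile equation tested with `ψ = σW`, the weak
divergence-free identity tested with `½σ|W|²` and the divergence theorem combine to `∫ Iₙ = 0` for the
fixed-`n` integrand `Iₙ` (and `Iₙ` is integrable). [folklore] -/
theorem integral_integrandN_eq_zero {γ : ℝ}
    {V W : EuclideanSpace ℝ (Fin 3) → EuclideanSpace ℝ (Fin 3)} {P σ : EuclideanSpace ℝ (Fin 3) → ℝ}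
    {S : Set (EuclideanSpace ℝ (Fin 3))} {R Cσ Cσ' : ℝ}
    (hVm : AEStronglyMeasurable V volume) (hPm : AEStronglyMeasurable P volume)
    (hσ : IsTestFunctionOn (⊤ : Opens (EuclideanSpace ℝ (Fin 3))) σ) (hKS : tsupport σ ⊆ S)
    (hxK : ∀ x ∈ tsupport σ, ‖x‖ ≤ R) (hR : 0 ≤ R) (hCσ : ∀ x, ‖σ x‖ ≤ Cσ)
    (hCσ' : ∀ x, ‖fderiv ℝ σ x‖ ≤ Cσ') (hW : ContDiff ℝ ∞ W) (hWdiv : ∀ x ∈ S, VectorCalculus.divergence W x = 0)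
    (hV2K : IntegrableOn (fun x => ‖V x‖ ^ 2) (tsupport σ) volume)
    (hV1K : IntegrableOn (fun x => ‖V x‖) (tsupport σ) volume)
    (hP1K : IntegrableOn (fun x => |P x|) (tsupport σ) volume)
    (hdiv : IsWeaklyDivFree V)
    (heq : ∀ ψ : EuclideanSpace ℝ (Fin 3) → EuclideanSpace ℝ (Fin 3),
      IsTestFunctionOn (⊤ : Opens (EuclideanSpace ℝ (Fin 3))) ψ →
        ∫ x, (⟪V x, fderiv ℝ ψ x (V x)⟫ + P x * VectorCalculus.divergence ψ x +
          γ * ⟪V x, fderiv ℝ ψ x x⟫ + (4 * γ - 1) * ⟪V x, ψ x⟫) = 0) :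
    Integrable (fun x => ((fderiv ℝ σ x) (V x) * ⟪(V x), (W x)⟫ + (σ x) * ⟪(V x), (fderiv ℝ W x) (V x)⟫ + (P x) * (fderiv ℝ σ x) (W x) +
          γ * ((fderiv ℝ σ x) x * ⟪(V x), (W x)⟫ + (σ x) * ⟪(V x), (fderiv ℝ W x) x⟫) + (4 * γ - 1) * ((σ x) * ⟪(V x), (W x)⟫) -
          ((1 / 2 : ℝ) * ((fderiv ℝ σ x) (V x) * ‖(W x)‖ ^ 2) + (σ x) * ⟪(W x), (fderiv ℝ W x) (V x)⟫) -
          γ * ((1 / 2 : ℝ) * ((fderiv ℝ σ x) x * ‖(W x)‖ ^ 2) + (σ x) * ⟪(W x), (fderiv ℝ W x) x⟫ + 3 * ((1 / 2 : ℝ) * ((σ x) * ‖(W x)‖ ^ 2))))) volume ∧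
      ∫ x, ((fderiv ℝ σ x) (V x) * ⟪(V x), (W x)⟫ + (σ x) * ⟪(V x), (fderiv ℝ W x) (V x)⟫ + (P x) * (fderiv ℝ σ x) (W x) +
          γ * ((fderiv ℝ σ x) x * ⟪(V x), (W x)⟫ + (σ x) * ⟪(V x), (fderiv ℝ W x) x⟫) + (4 * γ - 1) * ((σ x) * ⟪(V x), (W x)⟫) -
          ((1 / 2 : ℝ) * ((fderiv ℝ σ x) (V x) * ‖(W x)‖ ^ 2) + (σ x) * ⟪(W x), (fderiv ℝ W x) (V x)⟫) -
          γ * ((1 / 2 : ℝ) * ((fderiv ℝ σ x) x * ‖(W x)‖ ^ 2) + (σ x) * ⟪(W x), (fderiv ℝ W x) x⟫ + 3 * ((1 / 2 : ℝ) * ((σ x) * ‖(W x)‖ ^ 2)))) = 0 := by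
  -- supports and constants
  set K : Set (EuclideanSpace ℝ (Fin 3)) := tsupport σ with hKdef
  have hKc : IsCompact K := hσ.hasCompactSupport
  have hKm : MeasurableSet K := (isClosed_tsupport σ).measurableSet
  have hσK : ∀ x, x ∉ K → σ x = 0 := fun x hx => image_eq_zero_of_notMem_tsupport hx
  have hDσK : ∀ x, x ∉ K → fderiv ℝ σ x = 0 := fun x hx =>
    notMem_support.1 fun h => hx (support_fderiv_subset ℝ h)
  have hσd : Differentiable ℝ σ := hσ.contDiff.differentiable (by simp)
  have hσc : Continuous σ := hσ.contDiff.continuous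
  have hDσc : Continuous (fderiv ℝ σ) := hσ.contDiff.continuous_fderiv (by simp)
  have hCσ0 : 0 ≤ Cσ := (norm_nonneg _).trans (hCσ 0)
  have hCσ'0 : 0 ≤ Cσ' := (norm_nonneg _).trans (hCσ' 0)
  have hWd : Differentiable ℝ W := hW.differentiable (by simp)
  have hWc : Continuous W := hW.continuous
  have hDWc : Continuous (fderiv ℝ W) := hW.continuous_fderiv (by simp)
  have hqK : IntegrableOn (fun x => ‖V x‖ ^ 2 + |P x| + ‖V x‖) K volume := (hV2K.add hP1K).add hV1K
  -- the test field `ψ = σ W` and the test function `θ = ½ σ |W|²`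
  set ψ : EuclideanSpace ℝ (Fin 3) → EuclideanSpace ℝ (Fin 3) := fun x => σ x • W x with hψdef
  set θ : EuclideanSpace ℝ (Fin 3) → ℝ := fun x => (1 / 2 : ℝ) * (σ x * ‖W x‖ ^ 2) with hθdef
  have hψx : ∀ x, ψ x = σ x • W x := fun x => rfl
  have hθx : ∀ x, θ x = (1 / 2 : ℝ) * (σ x * ‖W x‖ ^ 2) := fun x => rfl
  have hψ : IsTestFunctionOn (⊤ : Opens (EuclideanSpace ℝ (Fin 3))) ψ := isTestFunctionOn_smul hσ hW
  have hθ : IsTestFunctionOn (⊤ : Opens (EuclideanSpace ℝ (Fin 3))) θ :=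
    isTestFunctionOn_half_mul_norm_sq hσ hW
  have hθd : Differentiable ℝ θ := hθ.contDiff.differentiable (by simp)
  have hθ1 : ContDiff ℝ 1 θ := hθ.contDiff.of_le (by exact_mod_cast le_top)
  have hψK : tsupport ψ ⊆ K := tsupport_smul_subset_left _ _
  have hθK : tsupport θ ⊆ K := by
    refine (tsupport_mul_subset_right).trans ((tsupport_mul_subset_left).trans le_rfl)
  -- pointwise formulas
  have hDψ : ∀ x v, fderiv ℝ ψ x v = fderiv ℝ σ x v • W x + σ x • fderiv ℝ W x v :=
    fun x v => fderiv_smul_apply_of_differentiable hσd hWd x v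
  have hdivψ : ∀ x, VectorCalculus.divergence ψ x = fderiv ℝ σ x (W x) := by
    intro x
    rw [hψdef, divergence_smul_of_differentiable hσd hWd x]
    by_cases hx : x ∈ S
    · rw [hWdiv x hx, mul_zero, add_zero]
    · rw [hσK x (fun h => hx (hKS h)), zero_mul, add_zero]
  have hDθ : ∀ x v, fderiv ℝ θ x v =
      (1 / 2 : ℝ) * (fderiv ℝ σ x v * ‖W x‖ ^ 2) + σ x * ⟪W x, fderiv ℝ W x v⟫ :=
    fun x v => fderiv_half_mul_norm_sq_apply hσd hWd x v
  -- the three identities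
  have e1 := heq ψ hψ
  have e2 : ∫ x, fderiv ℝ θ x (V x) = 0 := by
    have h := hdiv θ hθ
    simp_rw [inner_gradient_eq_fderiv_apply] at h
    exact h
  have hθi : Integrable θ volume := hθ.contDiff.continuous.integrable_of_hasCompactSupport hθ.hasCompactSupport
  have hDθc : Continuous (fderiv ℝ θ) := hθ1.continuous_fderiv one_ne_zero
  have hDθcs : HasCompactSupport (fderiv ℝ θ) := hθ.hasCompactSupport.fderiv (𝕜 := ℝ)
  have hDθxi : Integrable (fun x => fderiv ℝ θ x x) volume := by
    refine Continuous.integrable_of_hasCompactSupport (hDθc.clm_apply continuous_id) ?_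
    exact hDθcs.mono fun x hx => by
      intro h0
      apply hx
      change fderiv ℝ θ x x = 0
      rw [h0]; rfl
  have e3 : ∫ x, (fderiv ℝ θ x x + 3 * θ x) = 0 := by
    have h := integral_fderiv_apply_eq_neg_integral_mul_divergence_of_hasCompactSupport
      (v := fun y : EuclideanSpace ℝ (Fin 3) => y) contDiff_id hθ1 hθ.hasCompactSupport
    have hθ3 : ∫ x, θ x * VectorCalculus.divergence (fun y : EuclideanSpace ℝ (Fin 3) => y) x =
        ∫ x, 3 * θ x :=
      integral_congr_ae (Eventually.of_forall fun x => by
        show θ x * VectorCalculus.divergence (fun y : EuclideanSpace ℝ (Fin 3) => y) x = 3 * θ x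
        have hid : VectorCalculus.divergence (fun y : EuclideanSpace ℝ (Fin 3) => y) x = 3 := by
          unfold VectorCalculus.divergence
          rw [show (fun y : EuclideanSpace ℝ (Fin 3) => y) = id from rfl, fderiv_id]
          rw [ContinuousLinearMap.coe_id, LinearMap.trace_id, finrank_euclideanSpace, Fintype.card_fin]
          norm_num
        rw [hid, mul_comm])
    have h3i : Integrable (fun x => 3 * θ x) volume := hθi.const_mul 3
    calc ∫ x, (fderiv ℝ θ x x + 3 * θ x) = (∫ x, fderiv ℝ θ x x) + ∫ x, 3 * θ x :=
          integral_add hDθxi h3i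
      _ = 0 := by rw [h, hθ3]; ring
  -- bounds on `K`
  obtain ⟨MW₀, hMW₀⟩ := hKc.exists_bound_of_continuousOn hWc.continuousOn
  obtain ⟨MDW₀, hMDW₀⟩ := hKc.exists_bound_of_continuousOn hDWc.continuousOn
  set MW : ℝ := max MW₀ 0 with hMWdef
  set MDW : ℝ := max MDW₀ 0 with hMDWdef
  have hMW0 : 0 ≤ MW := le_max_right _ _
  have hMDW0 : 0 ≤ MDW := le_max_right _ _
  have hMW : ∀ x ∈ K, ‖W x‖ ≤ MW := fun x hx => (hMW₀ x hx).trans (le_max_left _ _)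
  have hMDW : ∀ x ∈ K, ‖fderiv ℝ W x‖ ≤ MDW := fun x hx => (hMDW₀ x hx).trans (le_max_left _ _)
  -- `ψ` and its derivative vanish off `K`
  have hψ0 : ∀ x, x ∉ K → ψ x = 0 := fun x hx => image_eq_zero_of_notMem_tsupport fun h => hx (hψK h)
  have hDψ0 : ∀ x, x ∉ K → fderiv ℝ ψ x = 0 := fun x hx =>
    notMem_support.1 fun h => hx (hψK (support_fderiv_subset ℝ h))
  obtain ⟨Cψ, hCψ⟩ := hψ.contDiff.continuous.bounded_above_of_compact_support hψ.hasCompactSupport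
  have hDψc : Continuous (fderiv ℝ ψ) := hψ.contDiff.continuous_fderiv (by simp)
  obtain ⟨Cψ', hCψ'⟩ := hDψc.bounded_above_of_compact_support (hψ.hasCompactSupport.fderiv (𝕜 := ℝ))
  have hCψ0 : 0 ≤ Cψ := (norm_nonneg _).trans (hCψ 0)
  have hCψ'0 : 0 ≤ Cψ' := (norm_nonneg _).trans (hCψ' 0)
  -- the `heq` integrand `t` is integrable
  set t : EuclideanSpace ℝ (Fin 3) → ℝ := fun x =>
    ⟪V x, fderiv ℝ ψ x (V x)⟫ + P x * VectorCalculus.divergence ψ x +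
      γ * ⟪V x, fderiv ℝ ψ x x⟫ + (4 * γ - 1) * ⟪V x, ψ x⟫ with htdef
  have hdivψc : Continuous (VectorCalculus.divergence ψ) :=
    continuous_divergence_of_contDiff_one (hψ.contDiff.of_le (by exact_mod_cast le_top))
  have htm : AEStronglyMeasurable t volume := by
    refine ((AEStronglyMeasurable.add (AEStronglyMeasurable.add ?_ ?_) ?_).add ?_)
    · exact hVm.inner (aestronglyMeasurable_clm_apply hDψc.aestronglyMeasurable hVm)
    · exact hPm.mul hdivψc.aestronglyMeasurable
    · exact (hVm.inner (aestronglyMeasurable_clm_apply hDψc.aestronglyMeasurable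
        continuous_id.aestronglyMeasurable)).const_mul γ
    · exact (hVm.inner hψ.contDiff.continuous.aestronglyMeasurable).const_mul (4 * γ - 1)
  have hti : Integrable t volume := by
    refine integrable_of_abs_le_on hKm htm hqK
      (C := Cψ' + Cσ' * MW + |γ| * Cψ' * R + |4 * γ - 1| * Cψ) (fun x hx => ?_) (fun x hx => ?_)
    · have hq0 : 0 ≤ ‖V x‖ ^ 2 + |P x| + ‖V x‖ := by positivity
      rw [abs_of_nonneg hq0]
      have hin : ∀ a b : EuclideanSpace ℝ (Fin 3), |⟪a, b⟫| ≤ ‖a‖ * ‖b‖ := fun a b => abs_real_inner_le_norm a b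
      have b1 : |⟪V x, fderiv ℝ ψ x (V x)⟫| ≤ Cψ' * ‖V x‖ ^ 2 := by
        refine (hin _ _).trans ?_
        have : ‖fderiv ℝ ψ x (V x)‖ ≤ Cψ' * ‖V x‖ :=
          ((fderiv ℝ ψ x).le_opNorm _).trans (mul_le_mul_of_nonneg_right (hCψ' x) (norm_nonneg _))
        calc ‖V x‖ * ‖fderiv ℝ ψ x (V x)‖ ≤ ‖V x‖ * (Cψ' * ‖V x‖) :=
              mul_le_mul_of_nonneg_left this (norm_nonneg _)
          _ = Cψ' * ‖V x‖ ^ 2 := by ring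
      have b2 : |P x * VectorCalculus.divergence ψ x| ≤ Cσ' * MW * |P x| := by
        rw [abs_mul, hdivψ x]
        have : |fderiv ℝ σ x (W x)| ≤ Cσ' * MW := by
          refine (Real.norm_eq_abs _ ▸ (fderiv ℝ σ x).le_opNorm _).trans ?_
          exact mul_le_mul (hCσ' x) (hMW x hx) (norm_nonneg _) hCσ'0
        calc |P x| * |fderiv ℝ σ x (W x)| ≤ |P x| * (Cσ' * MW) :=
              mul_le_mul_of_nonneg_left this (abs_nonneg _)
          _ = Cσ' * MW * |P x| := by ring
      have b3 : |γ * ⟪V x, fderiv ℝ ψ x x⟫| ≤ |γ| * Cψ' * R * ‖V x‖ := by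
        rw [abs_mul]
        have : ‖fderiv ℝ ψ x x‖ ≤ Cψ' * R :=
          ((fderiv ℝ ψ x).le_opNorm _).trans (mul_le_mul (hCψ' x) (hxK x hx) (norm_nonneg _) hCψ'0)
        calc |γ| * |⟪V x, fderiv ℝ ψ x x⟫| ≤ |γ| * (‖V x‖ * (Cψ' * R)) :=
              mul_le_mul_of_nonneg_left ((hin _ _).trans (mul_le_mul_of_nonneg_left this (norm_nonneg _)))
                (abs_nonneg _)
          _ = |γ| * Cψ' * R * ‖V x‖ := by ring
      have b4 : |(4 * γ - 1) * ⟪V x, ψ x⟫| ≤ |4 * γ - 1| * Cψ * ‖V x‖ := by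
        rw [abs_mul]
        calc |4 * γ - 1| * |⟪V x, ψ x⟫| ≤ |4 * γ - 1| * (‖V x‖ * Cψ) :=
              mul_le_mul_of_nonneg_left ((hin _ _).trans (mul_le_mul_of_nonneg_left (hCψ x) (norm_nonneg _)))
                (abs_nonneg _)
          _ = |4 * γ - 1| * Cψ * ‖V x‖ := by ring
      have hV0 : 0 ≤ ‖V x‖ := norm_nonneg _
      have hP0 : 0 ≤ |P x| := abs_nonneg _
      have hV20 : 0 ≤ ‖V x‖ ^ 2 := by positivity
      calc |t x| ≤ |⟪V x, fderiv ℝ ψ x (V x)⟫| + |P x * VectorCalculus.divergence ψ x| +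
            |γ * ⟪V x, fderiv ℝ ψ x x⟫| + |(4 * γ - 1) * ⟪V x, ψ x⟫| := by
            simp only [htdef]
            exact (abs_add_le _ _).trans (add_le_add ((abs_add_le _ _).trans
              (add_le_add (abs_add_le _ _) le_rfl)) le_rfl)
        _ ≤ Cψ' * ‖V x‖ ^ 2 + Cσ' * MW * |P x| + |γ| * Cψ' * R * ‖V x‖ + |4 * γ - 1| * Cψ * ‖V x‖ := by
            linarith
        _ ≤ (Cψ' + Cσ' * MW + |γ| * Cψ' * R + |4 * γ - 1| * Cψ) * (‖V x‖ ^ 2 + |P x| + ‖V x‖) := by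
            have h1 : Cψ' * ‖V x‖ ^ 2 ≤ Cψ' * (‖V x‖ ^ 2 + |P x| + ‖V x‖) :=
              mul_le_mul_of_nonneg_left (by linarith) hCψ'0
            have h2 : Cσ' * MW * |P x| ≤ Cσ' * MW * (‖V x‖ ^ 2 + |P x| + ‖V x‖) :=
              mul_le_mul_of_nonneg_left (by linarith) (by positivity)
            have h3 : |γ| * Cψ' * R * ‖V x‖ ≤ |γ| * Cψ' * R * (‖V x‖ ^ 2 + |P x| + ‖V x‖) :=
              mul_le_mul_of_nonneg_left (by linarith) (by positivity)
            have h4 : |4 * γ - 1| * Cψ * ‖V x‖ ≤ |4 * γ - 1| * Cψ * (‖V x‖ ^ 2 + |P x| + ‖V x‖) :=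
              mul_le_mul_of_nonneg_left (by linarith) (by positivity)
            linarith
    · simp [htdef, hψ0 x hx, hDψ0 x hx, hdivψ x, hDσK x hx]
  -- `a = Dθ(V)` is integrable
  have hai : Integrable (fun x => fderiv ℝ θ x (V x)) volume := by
    refine integrable_of_abs_le_on hKm (aestronglyMeasurable_clm_apply hDθc.aestronglyMeasurable hVm) hV1K
      (C := 1 / 2 * Cσ' * MW ^ 2 + Cσ * (MW * MDW)) (fun x hx => ?_) (fun x hx => ?_)
    · rw [hDθ x (V x), abs_of_nonneg (norm_nonneg _)]
      have hin : ∀ a b : EuclideanSpace ℝ (Fin 3), |⟪a, b⟫| ≤ ‖a‖ * ‖b‖ := fun a b => abs_real_inner_le_norm a b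
      have b1 : |(1 / 2 : ℝ) * (fderiv ℝ σ x (V x) * ‖W x‖ ^ 2)| ≤ 1 / 2 * Cσ' * MW ^ 2 * ‖V x‖ := by
        rw [abs_mul, abs_mul, abs_of_pos (by norm_num : (0 : ℝ) < 1 / 2), abs_pow, abs_norm]
        have h1 : |fderiv ℝ σ x (V x)| ≤ Cσ' * ‖V x‖ :=
          (Real.norm_eq_abs _ ▸ (fderiv ℝ σ x).le_opNorm _).trans
            (mul_le_mul_of_nonneg_right (hCσ' x) (norm_nonneg _))
        have h2 : ‖W x‖ ^ 2 ≤ MW ^ 2 := pow_le_pow_left₀ (norm_nonneg _) (hMW x hx) 2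
        calc (1 / 2 : ℝ) * (|fderiv ℝ σ x (V x)| * ‖W x‖ ^ 2) ≤ (1 / 2 : ℝ) * ((Cσ' * ‖V x‖) * MW ^ 2) :=
              mul_le_mul_of_nonneg_left (mul_le_mul h1 h2 (by positivity) (by positivity)) (by norm_num)
          _ = _ := by ring
      have b2 : |σ x * ⟪W x, fderiv ℝ W x (V x)⟫| ≤ Cσ * (MW * MDW) * ‖V x‖ := by
        rw [abs_mul]
        have h1 : ‖fderiv ℝ W x (V x)‖ ≤ MDW * ‖V x‖ :=
          ((fderiv ℝ W x).le_opNorm _).trans (mul_le_mul_of_nonneg_right (hMDW x hx) (norm_nonneg _))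
        have h2 : |⟪W x, fderiv ℝ W x (V x)⟫| ≤ MW * (MDW * ‖V x‖) :=
          (hin _ _).trans (mul_le_mul (hMW x hx) h1 (norm_nonneg _) hMW0)
        calc |σ x| * |⟪W x, fderiv ℝ W x (V x)⟫| ≤ Cσ * (MW * (MDW * ‖V x‖)) :=
              mul_le_mul ((Real.norm_eq_abs _).symm.le.trans (hCσ x)) h2 (abs_nonneg _) hCσ0
          _ = _ := by ring
      calc |(1 / 2 : ℝ) * (fderiv ℝ σ x (V x) * ‖W x‖ ^ 2) + σ x * ⟪W x, fderiv ℝ W x (V x)⟫|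
          ≤ _ := abs_add_le _ _
        _ ≤ 1 / 2 * Cσ' * MW ^ 2 * ‖V x‖ + Cσ * (MW * MDW) * ‖V x‖ := add_le_add b1 b2
        _ = (1 / 2 * Cσ' * MW ^ 2 + Cσ * (MW * MDW)) * ‖V x‖ := by ring
    · rw [hDθ x (V x), hσK x hx, hDσK x hx]
      simp
  have hbi : Integrable (fun x => fderiv ℝ θ x x + 3 * θ x) volume := hDθxi.add (hθi.const_mul 3)
  -- the pointwise identity and the conclusion
  have hpt : ∀ x, ((fderiv ℝ σ x) (V x) * ⟪(V x), (W x)⟫ + (σ x) * ⟪(V x), (fderiv ℝ W x) (V x)⟫ + (P x) * (fderiv ℝ σ x) (W x) +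
          γ * ((fderiv ℝ σ x) x * ⟪(V x), (W x)⟫ + (σ x) * ⟪(V x), (fderiv ℝ W x) x⟫) + (4 * γ - 1) * ((σ x) * ⟪(V x), (W x)⟫) -
          ((1 / 2 : ℝ) * ((fderiv ℝ σ x) (V x) * ‖(W x)‖ ^ 2) + (σ x) * ⟪(W x), (fderiv ℝ W x) (V x)⟫) -
          γ * ((1 / 2 : ℝ) * ((fderiv ℝ σ x) x * ‖(W x)‖ ^ 2) + (σ x) * ⟪(W x), (fderiv ℝ W x) x⟫ + 3 * ((1 / 2 : ℝ) * ((σ x) * ‖(W x)‖ ^ 2)))) = t x - fderiv ℝ θ x (V x) - γ * (fderiv ℝ θ x x + 3 * θ x) := by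
    intro x
    simp only [htdef, hDψ, hdivψ, hDθ, hψx, hθx, inner_add_right, real_inner_smul_right]
  have hsub : Integrable (fun x => t x - fderiv ℝ θ x (V x)) volume := hti.sub hai
  have hcm : Integrable (fun x => γ * (fderiv ℝ θ x x + 3 * θ x)) volume := hbi.const_mul γ
  refine ⟨?_, ?_⟩
  · have h : Integrable (fun x => t x - fderiv ℝ θ x (V x) - γ * (fderiv ℝ θ x x + 3 * θ x)) volume :=
      hsub.sub hcm
    exact (integrable_congr (Eventually.of_forall hpt)).2 h
  calc ∫ x, ((fderiv ℝ σ x) (V x) * ⟪(V x), (W x)⟫ + (σ x) * ⟪(V x), (fderiv ℝ W x) (V x)⟫ + (P x) * (fderiv ℝ σ x) (W x) +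
          γ * ((fderiv ℝ σ x) x * ⟪(V x), (W x)⟫ + (σ x) * ⟪(V x), (fderiv ℝ W x) x⟫) + (4 * γ - 1) * ((σ x) * ⟪(V x), (W x)⟫) -
          ((1 / 2 : ℝ) * ((fderiv ℝ σ x) (V x) * ‖(W x)‖ ^ 2) + (σ x) * ⟪(W x), (fderiv ℝ W x) (V x)⟫) -
          γ * ((1 / 2 : ℝ) * ((fderiv ℝ σ x) x * ‖(W x)‖ ^ 2) + (σ x) * ⟪(W x), (fderiv ℝ W x) x⟫ + 3 * ((1 / 2 : ℝ) * ((σ x) * ‖(W x)‖ ^ 2)))) = ∫ x, (t x - fderiv ℝ θ x (V x) - γ * (fderiv ℝ θ x x + 3 * θ x)) :=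
        integral_congr_ae (Eventually.of_forall hpt)
    _ = (∫ x, t x) - (∫ x, fderiv ℝ θ x (V x)) - γ * ∫ x, (fderiv ℝ θ x x + 3 * θ x) := by
        rw [integral_sub hsub hcm, integral_sub hti hai, integral_const_mul]
    _ = 0 := by
        have ht0 : ∫ x, t x = 0 := e1
        rw [ht0, e2, e3]
        ring

end FixedN


end ProfileEnergy

end Summit.NavierStokesRegularity.NavierStokesRegularity.Theorems.PowerGaugeEulerLiouville
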